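import Literature.NumberTheory.LFunctions.RosserSchoenfeldMertensFirstConstant
import Literature.NumberTheory.LFunctions.RosserSchoenfeldMertensFirstProofs
import HarnessLib

/-!
# `∑_p (log p)/(p(p−1)) < 1` and `∑_{n ≤ x} Λ(n)/n < log x + 1` (Rosser–Schoenfeld 1962, (3.24) with (2.8))

Literature/NumberTheory/LFunctions. PROOF file (theorems only; no definition, no named fact), joining
the two sibling proof files of `RosserSchoenfeldMertensFirst.lean` (J. B. Rosser, L. Schoenfeld,
*Approximate formulas for some functions of prime numbers*, Illinois J. Math. 6 (1962), 64–94):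

* `RosserSchoenfeldMertensFirstProofs.lean` discharges (3.24), `∑_{p≤x} (log p)/p < log x` (`x > 1`);
* `RosserSchoenfeldMertensFirstConstant.lean` identifies the constant `E = −γ − ∑_p (log p)/(p(p−1))`
  of (2.8) and proves `∑_{n = pᵏ, k ≥ 2} Λ(n)/n = ∑_p (log p)/(p(p−1))`
  (`RosserSchoenfeld.tsum_vonMangoldt_nonPrime_div`) with the partial-sum bound
  `RosserSchoenfeld.sum_vonMangoldt_nonPrime_div_le`.

Here:

* `RosserSchoenfeld.tsum_primes_log_div_mul_pred_lt_one` — **`∑_p (log p)/(p(p−1)) < 1`** (its value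
  is `−γ − E = 0.75536…` by (2.11); the proof takes the nine primes `p ≤ 23`, with
  `d log p ≤ c log 2` from `p^d ≤ 2^c` (`RosserSchoenfeld324.pow_log_le`) and Mathlib's
  `log 2 < 0.6931471808`, and telescopes the integer tail
  `∑_{n ≥ 24} log n/(n(n−1)) ≤ (log 23 + 2)/23`, `log n/(n(n−1)) ≤ F(n−1) − F(n)`,
  `F(t) = (log t + 2)/t`);
* `RosserSchoenfeld.sum_vonMangoldt_div_lt_log_add_one` — **`∑_{n ≤ x} Λ(n)/n < log x + 1` for real
  `x ≥ 1`**: `∑_{n≤x} Λ(n)/n = ∑_{p≤x} (log p)/p + ∑_{pᵏ≤x, k≥2} (log p)/pᵏ < log x + 1` by (3.24) and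
  the previous bound. This is the explicit constant the fact file's docstring asks for
  ("`∑_{n≤y} Λ(n)/n ≤ log y + 1`", for `Summit.RiemannHypothesis…WeilComb.CombHelsonBound`);
  asymptotically `∑_{n≤x} Λ(n)/n = log x − γ + o(1)`.

## References

* J. B. Rosser, L. Schoenfeld, Illinois J. Math. 6 (1962), 64–94: (2.8), (2.11), Cor. (3.24) p. 70.
  [RosserSchoenfeld1962]
-/

noncomputable section

open Filter Topology Set MeasureTheory Finset Real ArithmeticFunction
open scoped Chebyshev

namespace Literature.NumberTheory.LFunctions

namespace RosserSchoenfeld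

/-- Telescoping majorant: for `n ≥ 2`, `log n/(n(n−1)) ≤ F(n−1) − F(n)` with `F(t) = (log t + 2)/t`
(`n log(n/(n−1)) ≤ n/(n−1) ≤ 2`). [folklore] -/
theorem log_div_mul_pred_le_sub {n : ℕ} (hn : 2 ≤ n) :
    Real.log n / ((n : ℝ) * ((n : ℝ) - 1)) ≤
      (Real.log ((n : ℝ) - 1) + 2) / ((n : ℝ) - 1) - (Real.log n + 2) / n := by
  have hn' : (2 : ℝ) ≤ n := by exact_mod_cast hn
  have h1 : (0 : ℝ) < n - 1 := by linarith
  have h0 : (0 : ℝ) < n := by linarith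
  have hlog : Real.log n - Real.log ((n : ℝ) - 1) ≤ 1 / (n - 1) := by
    rw [← Real.log_div h0.ne' h1.ne']
    have := Real.log_le_sub_one_of_pos (show 0 < (n : ℝ) / (n - 1) by positivity)
    calc _ ≤ (n : ℝ) / (n - 1) - 1 := this
      _ = 1 / (n - 1) := by field_simp; ring
  have key : (n : ℝ) * (Real.log n - Real.log ((n : ℝ) - 1)) ≤ 2 := by
    calc (n : ℝ) * (Real.log n - Real.log ((n : ℝ) - 1)) ≤ n * (1 / (n - 1)) := by gcongr
      _ ≤ 2 := by rw [mul_one_div, div_le_iff₀ h1]; linarith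
  have hrepr : (Real.log ((n : ℝ) - 1) + 2) / ((n : ℝ) - 1) - (Real.log n + 2) / n -
      Real.log n / ((n : ℝ) * ((n : ℝ) - 1)) =
      (2 - n * (Real.log n - Real.log ((n : ℝ) - 1))) / (n * (n - 1)) := by
    field_simp
    ring
  have : 0 ≤ (2 - n * (Real.log n - Real.log ((n : ℝ) - 1))) / (n * (n - 1)) :=
    div_nonneg (by linarith) (by positivity)
  linarith [hrepr]

/-- The integer tail, telescoped: `∑_{i<m} log(i+N+1)/((i+N+1)(i+N)) ≤ (log N + 2)/N` (`N ≥ 1`).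
[folklore] -/
theorem sum_range_log_div_mul_pred_le (N m : ℕ) (hN : 1 ≤ N) :
    ∑ i ∈ Finset.range m, Real.log ((i + N + 1 : ℕ) : ℝ) /
        (((i + N + 1 : ℕ) : ℝ) * (((i + N + 1 : ℕ) : ℝ) - 1)) ≤ (Real.log N + 2) / N := by
  set F : ℕ → ℝ := fun k ↦ (Real.log k + 2) / k with hF
  have hstep : ∀ i ∈ Finset.range m, Real.log ((i + N + 1 : ℕ) : ℝ) /
      (((i + N + 1 : ℕ) : ℝ) * (((i + N + 1 : ℕ) : ℝ) - 1)) ≤ F (i + N) - F (i + N + 1) := by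
    intro i _
    have h := log_div_mul_pred_le_sub (n := i + N + 1) (by omega)
    have hc : (((i + N + 1 : ℕ) : ℝ) - 1) = ((i + N : ℕ) : ℝ) := by push_cast; ring
    rw [hc] at h ⊢
    exact h
  have hFnn : ∀ k : ℕ, 0 ≤ F k := fun k ↦
    div_nonneg (by linarith [Real.log_natCast_nonneg k]) (Nat.cast_nonneg k)
  have htel : ∀ m : ℕ, ∑ i ∈ Finset.range m, (F (i + N) - F (i + N + 1)) = F N - F (m + N) := by
    intro m
    induction m with
    | zero => simp
    | succ k ih => rw [Finset.sum_range_succ, ih, show k + 1 + N = k + N + 1 by ring]; ring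
  calc _ ≤ ∑ i ∈ Finset.range m, (F (i + N) - F (i + N + 1)) := Finset.sum_le_sum hstep
    _ = F N - F (m + N) := htel m
    _ ≤ F N := sub_le_self _ (hFnn _)
    _ = (Real.log N + 2) / N := rfl

/-- **`∑_p (log p)/(p(p−1)) < 1`** (numerically `0.75536…` by (2.11); here: the nine primes `p ≤ 23`
with `d log p ≤ c log 2` from `p^d ≤ 2^c` and `log 2 < 0.6931471808`, plus the integer tail
`∑_{n ≥ 24} log n/(n(n−1)) ≤ (log 23 + 2)/23`). [cite: RosserSchoenfeld1962, (2.8) with (2.11)] -/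
theorem tsum_primes_log_div_mul_pred_lt_one :
    ∑' p : Nat.Primes, Real.log (p : ℝ) / ((p : ℝ) * ((p : ℝ) - 1)) < 1 := by
  set g : ℕ → ℝ := fun n ↦ Real.log (n : ℝ) / ((n : ℝ) * ((n : ℝ) - 1)) with hg
  have hsub : ∑' p : Nat.Primes, g p = ∑' n : ℕ, (setOf Nat.Prime).indicator g n :=
    tsum_subtype (setOf Nat.Prime) g
  have hsumP : Summable (g ∘ ((↑) : (setOf Nat.Prime) → ℕ)) := summable_primes_log_div_mul_pred
  have hsum : Summable ((setOf Nat.Prime).indicator g) := summable_subtype_iff_indicator.mp hsumP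
  have hind : ∀ n, (setOf Nat.Prime).indicator g n = if n.Prime then g n else 0 := fun n ↦ by
    simp only [Set.indicator_apply, Set.mem_setOf_eq]
  change ∑' p : Nat.Primes, g p < 1
  rw [hsub, ← Summable.sum_add_tsum_nat_add 24 hsum]
  -- the head
  have hl2 : Real.log 2 < 0.6931471808 := Real.log_two_lt_d9
  have h3 := RosserSchoenfeld324.pow_log_le 3 5 2 8
  have h5 := RosserSchoenfeld324.pow_log_le 5 3 2 7
  have h7 := RosserSchoenfeld324.pow_log_le 7 7 2 20
  have h11 := RosserSchoenfeld324.pow_log_le 11 2 2 7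
  have h13 := RosserSchoenfeld324.pow_log_le 13 4 2 15
  have h17 := RosserSchoenfeld324.pow_log_le 17 2 2 9
  have h19 := RosserSchoenfeld324.pow_log_le 19 2 2 9
  have h23 := RosserSchoenfeld324.pow_log_le 23 1 2 5
  push_cast at h3 h5 h7 h11 h13 h17 h19 h23
  have hhead : ∑ i ∈ Finset.range 24, (setOf Nat.Prime).indicator g i ≤ 0.7256 := by
    simp only [Finset.sum_range_succ, Finset.sum_range_zero, hg]
    norm_num
    linarith
  -- the tail
  have htail : ∑' i : ℕ, (setOf Nat.Prime).indicator g (i + 24) ≤ (Real.log 23 + 2) / 23 := by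
    refine Real.tsum_le_of_sum_range_le (fun i ↦ ?_) (fun m ↦ ?_)
    · rw [hind]
      split_ifs
      · have : (24 : ℝ) ≤ ((i + 24 : ℕ) : ℝ) := by exact_mod_cast Nat.le_add_left 24 i
        rw [hg]
        dsimp only
        exact div_nonneg (Real.log_nonneg (by linarith)) (by nlinarith)
      · exact le_rfl
    · calc ∑ i ∈ Finset.range m, (setOf Nat.Prime).indicator g (i + 24)
          ≤ ∑ i ∈ Finset.range m, g (i + 23 + 1) := by
            refine Finset.sum_le_sum fun i _ ↦ ?_
            rw [hind, show i + 23 + 1 = i + 24 by ring]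
            split_ifs
            · exact le_rfl
            · have : (24 : ℝ) ≤ ((i + 24 : ℕ) : ℝ) := by exact_mod_cast Nat.le_add_left 24 i
              rw [hg]
              dsimp only
              exact div_nonneg (Real.log_nonneg (by linarith)) (by nlinarith)
        _ ≤ (Real.log (23 : ℕ) + 2) / (23 : ℕ) := sum_range_log_div_mul_pred_le 23 m (by norm_num)
        _ = (Real.log 23 + 2) / 23 := by norm_num
  have htail' : (Real.log 23 + 2) / 23 ≤ 0.2377 := by
    rw [div_le_iff₀ (by norm_num)]
    linarith
  linarith

/-- **`∑_{n ≤ x} Λ(n)/n < log x + 1` for real `x ≥ 1`**: `∑_{n≤x} Λ(n)/n = ∑_{p≤x} (log p)/p +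
∑_{pᵏ ≤ x, k ≥ 2} (log p)/pᵏ`, the first sum is `< log x` for `x > 1` by Rosser–Schoenfeld's (3.24)
(`RosserSchoenfeld1962_eq_3_24_holds`, `RosserSchoenfeldMertensFirstProofs.lean`), the second is at most
`∑_p (log p)/(p(p−1)) < 1` (numerically `log x − γ + o(1)`, and `< log x + 0.7554`).
[cite: RosserSchoenfeld1962, (3.24) with (2.8), (2.11)] -/
theorem sum_vonMangoldt_div_lt_log_add_one {x : ℝ} (hx : 1 ≤ x) :
    ∑ n ∈ Finset.Ioc 0 ⌊x⌋₊, (Λ n : ℝ) / n < Real.log x + 1 := by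
  set N := ⌊x⌋₊ with hN
  have hsplit : ∑ n ∈ Finset.Ioc 0 N, (Λ n : ℝ) / n =
      (∑ p ∈ Nat.primesLE N, Real.log p / p) +
        ∑ n ∈ Finset.Ioc 0 N, (if n.Prime then 0 else (Λ n : ℝ)) / n := by
    have h1 : ∀ n : ℕ, (Λ n : ℝ) / n =
        (if n.Prime then Real.log n / n else 0) + (if n.Prime then 0 else (Λ n : ℝ)) / n := by
      intro n
      split_ifs with hp
      · rw [vonMangoldt_apply_prime hp]; ring
      · ring
    rw [Finset.sum_congr rfl fun n _ ↦ h1 n, Finset.sum_add_distrib, ← Finset.sum_filter,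
      Nat.primesLE_eq_filter_Ioc_zero]
  have hD : ∑ n ∈ Finset.Ioc 0 N, (if n.Prime then 0 else (Λ n : ℝ)) / n < 1 := by
    calc _ ≤ ∑' n : ℕ, (if n.Prime then 0 else (Λ n : ℝ)) / n :=
          summable_vonMangoldt_nonPrime_div.sum_le_tsum _ fun k _ ↦ by
            positivity [vonMangoldt_nonneg (n := k)]
      _ = _ := tsum_vonMangoldt_nonPrime_div
      _ < 1 := tsum_primes_log_div_mul_pred_lt_one
  have hP : ∑ p ∈ Nat.primesLE N, Real.log p / p ≤ Real.log x := by
    rcases eq_or_lt_of_le hx with h | h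
    · have hN1 : N = 1 := by rw [hN, ← h]; simp
      rw [hN1, show Nat.primesLE 1 = ∅ by decide, Finset.sum_empty]
      exact Real.log_nonneg hx
    · exact (RosserSchoenfeld1962_eq_3_24_holds x h).le
  rw [hsplit]
  linarith

end RosserSchoenfeld

end Literature.NumberTheory.LFunctions

end
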